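import Summits.SmoothPoincare4.SmoothPoincare4.Theses.DottedCircleRasmussen
import Summits.SmoothPoincare4.SmoothPoincare4.Theses.SchoenfliesSplit
import Literature.Topology.FourManifolds.PalaisBallComplement
import Literature.Topology.FourManifolds.LevelPassageSurgery
import Literature.Topology.FourManifolds.HomotopyBallSliceSphereProofs

/-!
# SmoothPoincare4 / DottedCircleRasmussen — crux `DcrRigidity` (stmt-SmoothPoincare4-17014), line `Sketch`:
# the apex X = `SchsplitPuncturedEmbeds` is implied by the summit (hardness record)

The registered skeleton `Cruxes/DcrRigidity/Lines/Sketch.lean` closes the kill switch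
`DcrRigidity := ¬ DcrGap` modulo ONE open stub, X = `SchoenfliesSplit.SchsplitPuncturedEmbeds`
(item stmt-SmoothPoincare4-0371: every punctured homotopy 4-sphere embeds smoothly in `ℝ⁴`, i.e.
every homotopy 4-sphere is invertible).  This file records, def-free over tree vocabulary, that X
is SPC4-implied, completing the sandwich

  `SmoothPoincare4 ⇒ SchsplitPuncturedEmbeds ⇒ DcrRigidity ⇒ ¬(FGMW gap)`

(second arrow: landed `dcrRigidity_of_schsplitPuncturedEmbeds`; third: landed
`DcrGap.Negative.not_fgmw_of_not_dcrGap`), all four statements open: refuting X means exhibiting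
an exotic (indeed non-invertible) 4-sphere, so no worker, fact or computation can move the line's
last stub short of progress on SPC4 itself.

* `helper_apexOfSmoothPoincare4 : SmoothPoincare4 → SchsplitPuncturedEmbeds` (with the landed
  `dcrRigidity_of_schsplitPuncturedEmbeds` it recovers `dcrRigidity_of_smoothPoincare4`) — under SPC4 the
  homotopy sphere `S` has a diffeomorphism `ψ : S ≃ₘ S⁴`, and `S ∖ {p}` embeds in `ℝ⁴` by `ψ`
  followed by the stereographic projection from `ψ p` (a chart of `S⁴` with source `{ψ p}ᶜ` and
  full target), restricted to the open submanifold `{p}ᶜ`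
  (`isSmoothEmbedding_comp_subtypeVal_of_subset_source`).

References: M. Freedman, R. Gompf, S. Morrison, K. Walker, Quantum Topol. 1 (2010), §1, fn. 1
[FreedmanGompfMorrisonWalker2010]; R. Kirby (ed.), *Problems in low-dimensional topology* (1997),
Problem 4.89 [Kirby1997].
-/

noncomputable section

-- the prescribed namespace `Summit.<P>.<Sub>.…` duplicates `SmoothPoincare4` (P = Sub)
set_option linter.dupNamespace false

open scoped Manifold ContDiff Topology ContinuousMap
open Set Function Metric
open Literature.Topology.FourManifolds
open Summit.SmoothPoincare4.SmoothPoincare4.Theses.DottedCircleRasmussen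
open Summit.SmoothPoincare4.SmoothPoincare4.Theses.SchoenfliesSplit (SchsplitPuncturedEmbeds)

namespace Summit.SmoothPoincare4.SmoothPoincare4.Cruxes.DcrRigidity.Sketch

/-- **The apex of line `Sketch` is SPC4-implied: `SmoothPoincare4 → SchsplitPuncturedEmbeds`.**
If every homotopy 4-sphere is diffeomorphic to `S⁴`, then every punctured homotopy 4-sphere
`S ∖ {p}` embeds smoothly in `ℝ⁴`: compose a diffeomorphism `ψ : S ≃ₘ S⁴` with the stereographic
projection `σ` from `ψ p` (smooth on its source `{ψ p}ᶜ`, with smooth inverse on its target `ℝ⁴`)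
and restrict the resulting partial diffeomorphism `σ ∘ ψ` (source exactly `{p}ᶜ`) to the open
submanifold `{p}ᶜ`. [cite: FreedmanGompfMorrisonWalker2010, §1] -/
theorem helper_apexOfSmoothPoincare4 (hS : _root_.SmoothPoincare4) : SchsplitPuncturedEmbeds := by
  intro S p
  obtain ⟨ψ⟩ := hS S.carrier inferInstance inferInstance S.nonempty_homotopyEquiv.some
  letI := Knot.fact_finrank_euclideanSpace_four_add_one
  -- the partial diffeomorphism `σ ∘ ψ : S ⇀ ℝ⁴`, source `{p}ᶜ`, target `ℝ⁴`
  set Φ : OpenPartialHomeomorph S.carrier (EuclideanSpace ℝ (Fin 4)) :=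
    ψ.toHomeomorph.toOpenPartialHomeomorph.trans (stereographic' 4 (ψ p)) with hΦ
  have hψv : ∀ x, ψ.toHomeomorph x = ψ x := fun x => rfl
  have hsrc : Φ.source = {p}ᶜ := by
    ext x
    simp only [hΦ, OpenPartialHomeomorph.trans_source, Homeomorph.toOpenPartialHomeomorph_source,
      univ_inter, mem_preimage, stereographic'_source, mem_compl_iff, mem_singleton_iff,
      Homeomorph.toOpenPartialHomeomorph_apply, hψv]
    exact not_congr ψ.injective.eq_iff
  have htgt : Φ.target = univ := by
    simp only [hΦ, OpenPartialHomeomorph.trans_target, stereographic'_target, univ_inter,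
      Homeomorph.toOpenPartialHomeomorph_target, preimage_univ]
  have hΦs : ContMDiffOn (𝓡 4) (𝓡 4) ∞ Φ Φ.source := by
    rw [hsrc]
    have h1 : ContMDiffOn (𝓡 4) (𝓡 4) ∞ (stereographic' 4 (ψ p)) {ψ p}ᶜ :=
      contMDiffOn_stereographic' (ψ p)
    refine (h1.comp ψ.contMDiff.contMDiffOn fun x hx => ?_).congr fun x _ => rfl
    simp only [mem_compl_iff, mem_singleton_iff] at hx ⊢
    exact fun h => hx (ψ.injective h)
  have hΦs' : ContMDiffOn (𝓡 4) (𝓡 4) ∞ Φ.symm Φ.target := by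
    rw [htgt]
    exact ((ψ.symm.contMDiff.comp (contMDiff_stereographic'_symm (ψ p))).contMDiffOn
      (s := univ)).congr fun x _ => rfl
  -- `{p}ᶜ` is nonempty: the antipode of `ψ p` pulls back to a point other than `p`
  haveI hne : Nonempty (↥((⟨{p}ᶜ, isOpen_compl_singleton⟩ : TopologicalSpace.Opens S.carrier))) := by
    refine ⟨⟨ψ.symm (-ψ p), ?_⟩⟩
    change ψ.symm (-ψ p) ∈ ({p}ᶜ : Set S.carrier)
    rw [mem_compl_iff, mem_singleton_iff]
    intro h
    have h' : -ψ p = ψ p := by simpa using congrArg ψ h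
    exact ne_neg_of_mem_unit_sphere ℝ (ψ p) h'.symm
  have hU : ((((⟨{p}ᶜ, isOpen_compl_singleton⟩ : TopologicalSpace.Opens S.carrier)) :
      Set S.carrier)) ⊆ Φ.source := by
    rw [hsrc]
    rfl
  exact ⟨Φ ∘ Subtype.val, (isSmoothEmbedding_comp_subtypeVal_of_subset_source Φ hΦs hΦs'
    (ContinuousLinearEquiv.refl ℝ (EuclideanSpace ℝ (Fin 4))) _ hU).1⟩

end Summit.SmoothPoincare4.SmoothPoincare4.Cruxes.DcrRigidity.Sketch

end
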